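/-
Copyright: statement-level skeleton of a published paper (lit-balaban cell, Phase-2 proof seat p32 gen 41). No proof claims
beyond what the kernel checks below.
-/
import Mathlib
import Literature.MathematicalPhysics.QuantumFieldTheory.Balaban1983to89.B3Sect1TwoPoint

/-!
# B3 — T. Bałaban, *(Higgs)₂,₃ quantum fields in a finite volume. III. Renormalization*, CMP **88** (1983) 411–445
[Balaban1983Higgs3], p. 416 [PDF 6], display **(1.21)**: the DYSON / ONE-PARTICLE-IRREDUCIBLE RESUMMATION as a combinatorial
identity on graph-indexed kernels, in the ring of formal power series in the couplings

statement-level skeleton of published theorems with citation tags; proofs where landed; nothing here is a claim about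
the Yang–Mills mass gap

THE PRINTED TEXT, p. 416 [PDF 6], verbatim: *"The function G^ε has a perturbative expansion of the following structure
G^ε = Σ_{n=0}^{∞} C^ε_0[(−δm² + Σ^ε + ∂^{ε*}Σ^ε_1 + Σ^{ε*}_1∂^ε + ∂^{ε*}Σ^ε_2∂^ε)C^ε_0]ⁿ, (1.21) where C^ε_0 = (−Δ^ε_0 + m²)^{−1} and
Σ^ε, Σ^ε_1, Σ^ε_2 are given by amputated, one-particle-irreducible graphs of the expansion of G^ε."*

PDF held: `paper:balaban1983-higgs-2-3-quantum-fields-finite-volume` (journal page = PDF page + 410); p. 416 read in the OCR text layer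
and on the render `pub-balaban/b2b-balaban-ref1/pages/1983-cmp88-higgs23-III/1983-cmp88-higgs23-III-p006-x2.png`; the display above is the
cell of record of SKELETON row **B3.Eq1.19-1.22** (`HOME/lit-balaban-r15/ROWS-B3.md`, fold owner r15; this file = a located member of its
(1.21) cell, written for the owner's HEAD QUESTION 25, 2026-08-23T07:43:33Z, reading (T), second half: *"Dyson/1PI resummation as a
combinatorial identity on graph-indexed kernels"*).

CONTEXT.  r15's `B3Sect1TwoPoint` (p243974) types (1.21) in an arbitrary ring of operators — the `n`-th term `dysonTerm C₀ X n =
C₀(XC₀)ⁿ` and the RESUMMED form `Eq121 G C₀ X : G = C₀ + G·X·C₀` — with the self-energy `X` a letter; p32 gen 40's `B3Eq121DysonSeries`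
(p356416/p357122) sums the series in a normed operator ring for `‖XC₀‖ < 1`.  What neither models is the COMBINATORIAL content of the
sentence: in perturbation theory `G^ε` is the sum over the connected two-point graphs of the expansion, every such graph is a CHAIN
`C₀ K₁ C₀ K₂ C₀ ⋯ K_m C₀` of amputated one-particle-irreducible (1PI) insertions `K_j` joined by free propagators, and resumming the
chains by the number `n` of insertions gives (1.21) with `X = Σ_{1PI graphs K} K` — an identity of FORMAL power series in the couplings
`(e, λ)`, finite order by order because every 1PI graph has positive order.  THIS FILE proves exactly that, at the level of
graph-indexed kernels:

* DATA (`§3`).  `ι` — an index type for the amputated 1PI two-point INSERTIONS of the expansion: the amputated 1PI graphs of `Σ^ε`,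
  `Σ^ε_1`, `Σ^ε_2` (with their derivative legs) and the mass-counterterm insertions `−δm²` (print's separate letter: a bare vertex (1.7)
  is not a graph, p. 415 *"There is at least one internal line"*; the five letters are split in the companion `B3Eq121OnePIChainsLetters`);
  `amp : ι → R` — their values as operator kernels in a ring `R` (noncommutative: operators on the fields on `T_ε`); `deg : ι → σ →₀ ℕ`
  — their orders in the coupling letters `σ` (for (1.21): `σ = Fin 2`, the exponents `(α, β)` of `e^α λ^β`, cf. (1.23) p. 417
  *"δm² = Σ_{2≦α+2β≦4} e^αλ^β δm²_{(α,β)}"*); hypotheses `∀ i, deg i ≠ 0` (a 1PI self-energy graph has at least one vertex, the vertices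
  (1.6), (1.8), (1.10) carry couplings, and `δm²` is of order ≥ 2 by (1.23)) and `∀ d, {i | deg i = d}.Finite` (finitely many
  insertions of each order).  The free propagator `C₀ : R`.
* CHAINS (`§1`).  A connected two-point graph of the expansion is indexed by the `List ι` of its 1PI pieces read from `x` to `x′`;
  its value is `chainAmp C₀ amp [i₁, …, i_m] = C₀·amp i₁·C₀·amp i₂·C₀ ⋯ amp i_m·C₀` and its order `chainDeg deg l = Σ_j deg i_j`.
* SERIES (`§3`).  In `MvPowerSeries σ R` (= `R[[e, λ]]` for `σ = Fin 2`): the self-energy `sigmaSeries amp deg := Σ_i e^{deg i}·amp i`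
  and the two-point function `greenSeries C₀ amp deg := Σ_{chains l} e^{chainDeg l}·chainAmp l`, both defined COEFFICIENTWISE
  (`coeff_sigmaSeries`, `coeff_greenSeries`: at each order a finite sum — `finite_chainDeg_eq`, PROVED from the two hypotheses).
* THEOREMS.  `§2` **`sum_chainAmp_ofFn`** — the ungraded identity for a finite family: `Σ_{f : Fin n → ι} chainAmp (ofFn f) =
  dysonTerm C₀ (Σ_i amp i) n` (the `n`-th term of (1.21) IS the sum of the chains of `n` insertions).  `§5` **`coeff_dysonTerm_eq_sum_chains`**
  — graded form: at every order `d`, `coeff d (dysonTerm (C C₀) Σ n)` = the sum of `chainAmp l` over the chains `l` of exactly `n` 1PI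
  insertions and total order `d`; `coeff_dysonTerm_eq_zero_of_degree_lt` (no chain of `n` insertions below total order `n`).
  `§6` **`coeff_greenSeries_eq_sum_dysonTerm`** — (1.21) ORDER BY ORDER: `coeff d G = Σ_{n ≤ |d|} coeff d (C₀[XC₀]ⁿ)`, the printed
  `Σ_{n=0}^∞` being a finite sum at each order (`coeff_greenSeries_eq_coeff_partialSum`: = the order-`d` part of r15's partial sum
  of `dyson_partial` for any cut-off `N > |d|`; at total order 1, `coeff_greenSeries_of_degree_eq_one`: `coeff d G = C₀·(coeff d X)·C₀`,
  i.e. «G = C₀ + C₀·Σ_{(0,1)}·C₀ + O(λ²)» for the use of `B3Eq122FirstOrderWick`); `§7` **`hasSum_dysonTerm_greenSeries`** / **`greenSeries_eq_tsum_dysonTerm`** — the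
  printed infinite series converges to `G` in the topology of formal power series (product topology on coefficients, any topology on
  `R`) and `G = Σ'_n C₀[XC₀]ⁿ` literally.  `§4` **`eq121_greenSeries`** — r15's resummed form `Eq121 G (C C₀) X` holds EXACTLY in
  `R[[σ]]` for the chain series, and `§8` **`eq_greenSeries_of_eq121`** — it has no other solution there (`1 − XC₀` has constant
  coefficient `1`), so the typed (1.21) of record and the chain expansion define the same formal two-point function
  (`eq121_iff_eq_greenSeries`).
HONEST SCOPE.  (i) Kernel/series level only: the graph-theoretic fact behind the indexing — a connected graph with two external legs
is, uniquely, a chain of its maximal 1PI pieces separated by its bridges — is the standard convention by which connected two-point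
graphs are ENUMERATED here (as lists of 1PI insertions); it is not derived on the tree's concrete graphs `B3Cor23Concrete.Graph`
(connectedness is not part of that structure; a model predicate — connected, and connected after cutting any one internal line — is
p37's `B3OnePIGraphs.IsOnePI` (p358806, landed after this file's v1.0; the seven (1.22) pictures decided there), and instantiating `ι`
with such graphs would need their amputated kernels as a function on graphs, which the tree does not have).  (ii) No Wick/Gaussian
step: that the coefficients of the concrete (1.19) `B3Sect1TwoPoint.twoPoint` ARE graph sums is p39's lane (first order) and p33's
(`B3TwoPointPerturbativeCoefficients`, the Taylor coefficients to all orders); nothing here identifies `greenSeries` with (1.19).  (iii) The five printed letters of `X = selfEnergy121 …` correspond to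
a partition of `ι` by the type of the insertion (mass counterterm (1.7); no / left / right / both derivative legs); at the kernel level
they are all "amputated 1PI two-point insertions" and enter through `amp`, so `X = sigmaSeries amp deg` (`sigmaSeries_sum` splits a
disjoint union of index types additively).  (iv) `R` is any ring; no convergence in operator norm is used or claimed (that is
`B3Eq121DysonSeries`).  Definitions with bodies (`insAmp`, `chainAmp`, `chainDeg`, `sigmaSeries`, `greenSeries`), theorems; no `Prop`
facts, no sorry; Mathlib + `B3Sect1TwoPoint` only; standard axioms.  Unit `lit-balaban-p32` (Phase-2 proof seat p32, gen 41), HOME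
`run/shared/lean/pub/lit-balaban/`, 2026-08-23.  Row B3.Eq1.19-1.22 reads `proved` under the lead's HEAD WORD Q25 (2026-08-23T08:24:18Z,
reading (P)); this file is an OPTIONAL located member of its (1.21) cell (zero head weight).  v1.1 (doc-only): `ι` described as
insertions (graphs + `−δm²`), pointer to p37's `B3OnePIGraphs.IsOnePI` (v1.0 said "the tree has no 1PI predicate", true when filed),
p33's coefficient file named; declarations byte-identical to v1.0 (p358597).
-/

open scoped BigOperators
-- `Finset.antidiagonal` alone resolves to the `Set.IsPWO` antidiagonal of `Data.Finset.MulAntidiagonal`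
open Finset.HasAntidiagonal (antidiagonal mem_antidiagonal)

namespace Literature.MathematicalPhysics.QuantumFieldTheory.Balaban1983to89.B3Eq121OnePIChains

open B3Sect1TwoPoint (dysonTerm Eq121)
open MvPowerSeries

noncomputable section

variable {R : Type*} [Ring R] {ι : Type*} {σ : Type*}

/-! ## §1 Chains of one-particle-irreducible insertions and their kernels -/

section Chains

variable (C0 : R) (amp : ι → R)

/-- The amputated value of a chain of 1PI insertions with the free propagators BETWEEN and AFTER them:
`insAmp C₀ amp [i₁, …, i_m] = amp i₁·C₀·amp i₂·C₀ ⋯ amp i_m·C₀` (the factor `[XC₀]ⁿ` of (1.21), one graph per slot).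
[cite: Balaban1983Higgs3, (1.21) p.416] -/
def insAmp (l : List ι) : R :=
  (l.map fun i => amp i * C0).prod

/-- The value of the connected two-point graph whose 1PI pieces, read from `x` to `x′`, are `i₁, …, i_m`:
`chainAmp C₀ amp [i₁, …, i_m] = C₀·amp i₁·C₀·amp i₂·C₀ ⋯ amp i_m·C₀` (the term `C₀[XC₀]ⁿ` of (1.21), one graph per slot; the empty
chain is the free propagator `C₀`). [cite: Balaban1983Higgs3, (1.21) p.416] -/
def chainAmp (l : List ι) : R :=
  C0 * insAmp C0 amp l

variable {C0 amp}

/-- kernel: no insertion. [cite: Balaban1983Higgs3, (1.21) p.416] -/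
@[simp] theorem insAmp_nil : insAmp C0 amp [] = 1 := by
  simp [insAmp]

/-- kernel: first insertion split off. [cite: Balaban1983Higgs3, (1.21) p.416] -/
@[simp] theorem insAmp_cons (i : ι) (l : List ι) : insAmp C0 amp (i :: l) = amp i * C0 * insAmp C0 amp l := by
  simp [insAmp]

/-- kernel: insertions are multiplicative under concatenation of chains. [cite: Balaban1983Higgs3, (1.21) p.416] -/
theorem insAmp_append (l₁ l₂ : List ι) : insAmp C0 amp (l₁ ++ l₂) = insAmp C0 amp l₁ * insAmp C0 amp l₂ := by
  simp [insAmp, List.prod_append]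

/-- The empty chain is the free propagator `C₀` (the `n = 0` term of (1.21)). [cite: Balaban1983Higgs3, (1.21) p.416] -/
@[simp] theorem chainAmp_nil : chainAmp C0 amp [] = C0 := by
  simp [chainAmp]

/-- `chainAmp (i :: l) = C₀·amp i·chainAmp l`. [cite: Balaban1983Higgs3, (1.21) p.416] -/
theorem chainAmp_cons (i : ι) (l : List ι) : chainAmp C0 amp (i :: l) = C0 * amp i * chainAmp C0 amp l := by
  simp only [chainAmp, insAmp_cons, mul_assoc]

/-- `chainAmp (l₁ ++ l₂) = chainAmp l₁ · insAmp l₂`. [cite: Balaban1983Higgs3, (1.21) p.416] -/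
theorem chainAmp_append (l₁ l₂ : List ι) :
    chainAmp C0 amp (l₁ ++ l₂) = chainAmp C0 amp l₁ * insAmp C0 amp l₂ := by
  simp only [chainAmp, insAmp_append, mul_assoc]

/-- Appending one insertion: `chainAmp (l ++ [i]) = chainAmp l · amp i · C₀` — the step `G ↦ G·X·C₀` of the resummed form
`Eq121`. [cite: Balaban1983Higgs3, (1.21) p.416] -/
theorem chainAmp_concat (l : List ι) (i : ι) : chainAmp C0 amp (l ++ [i]) = chainAmp C0 amp l * amp i * C0 := by
  rw [chainAmp_append, insAmp_cons, insAmp_nil, mul_one, mul_assoc]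

/-- A single insertion: `C₀·amp i·C₀`. [cite: Balaban1983Higgs3, (1.21) p.416] -/
theorem chainAmp_singleton (i : ι) : chainAmp C0 amp [i] = C0 * amp i * C0 := by
  rw [chainAmp_cons, chainAmp_nil]

end Chains

/-! ## §2 The ungraded identity for a finite family of insertions -/

section Ungraded

variable [Fintype ι] (C0 : R) (amp : ι → R)

/-- **The `n`-th term of (1.21) is the sum of the chains of `n` insertions** (finite family of 1PI kernels, no grading):
`Σ_{f : Fin n → ι} C₀·amp(f 0)·C₀ ⋯ amp(f (n−1))·C₀ = C₀[(Σ_i amp i)C₀]ⁿ = dysonTerm C₀ (Σ_i amp i) n` — noncommutative expansion of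
the `n`-th power of a sum. PROVED. [cite: Balaban1983Higgs3, (1.21) p.416] -/
theorem sum_chainAmp_ofFn (n : ℕ) :
    ∑ f : Fin n → ι, chainAmp C0 amp (List.ofFn f) = dysonTerm C0 (∑ i, amp i) n := by
  induction n with
  | zero => simp [dysonTerm]
  | succ n ih =>
    calc ∑ f : Fin (n + 1) → ι, chainAmp C0 amp (List.ofFn f)
        = ∑ p : ι × (Fin n → ι), chainAmp C0 amp (List.ofFn (Fin.cons p.1 p.2 : Fin (n + 1) → ι)) := by
          rw [← (Fin.consEquiv fun _ : Fin (n + 1) => ι).sum_comp]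
          rfl
      _ = ∑ i : ι, ∑ g : Fin n → ι, C0 * amp i * chainAmp C0 amp (List.ofFn g) := by
          rw [Fintype.sum_prod_type]
          simp only [List.ofFn_succ, Fin.cons_zero, Fin.cons_succ, chainAmp_cons]
      _ = ∑ i : ι, C0 * amp i * dysonTerm C0 (∑ i, amp i) n := by
          simp only [← Finset.mul_sum, ih]
      _ = dysonTerm C0 (∑ i, amp i) (n + 1) := by
          rw [← Finset.sum_mul, ← Finset.mul_sum, dysonTerm, dysonTerm, pow_succ']
          simp only [mul_assoc]

/-- The same with r15's finite iteration: for a finite family, `Σ_{n<N} Σ_{f : Fin n → ι} chainAmp (ofFn f)` is the partial sum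
`Σ_{n<N} dysonTerm C₀ (Σ_i amp i) n` of (1.21) (cf. `B3Sect1TwoPoint.dyson_partial`). [cite: Balaban1983Higgs3, (1.21) p.416] -/
theorem sum_range_sum_chainAmp_ofFn (N : ℕ) :
    ∑ n ∈ Finset.range N, ∑ f : Fin n → ι, chainAmp C0 amp (List.ofFn f)
      = ∑ n ∈ Finset.range N, dysonTerm C0 (∑ i, amp i) n := by
  simp only [sum_chainAmp_ofFn]

end Ungraded

/-! ## §3 Graph-indexed kernels with orders: the self-energy and the two-point function as formal power series -/

section Series

variable (C0 : R) (amp : ι → R) (deg : ι → σ →₀ ℕ)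

/-- The order of a chain in the couplings: the sum of the orders of its 1PI pieces (orders of graphs add under composition, the
propagators `C₀` carry no coupling). [cite: Balaban1983Higgs3, (1.21) p.416] -/
def chainDeg (l : List ι) : σ →₀ ℕ :=
  (l.map deg).sum

/-- **The self-energy of (1.21) as a formal power series in the couplings**: `X = Σ_{1PI graphs i} e^{deg i}·amp i ∈ R[[σ]]`,
i.e. `coeff d X = Σ_{i : deg i = d} amp i` (a finite sum for a locally finite family, `coeff_sigmaSeries`; `finsum` = 0 otherwise).
This is print's `−δm² + Σ^ε + ∂^{ε*}Σ^ε_1 + Σ^{ε*}_1∂^ε + ∂^{ε*}Σ^ε_2∂^ε` with every amputated 1PI two-point insertion entered through its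
kernel `amp i` (module docstring (iii)). [cite: Balaban1983Higgs3, (1.21) p.416] -/
def sigmaSeries : MvPowerSeries σ R :=
  fun d => ∑ᶠ (i : ι) (_ : deg i = d), amp i

/-- **The two-point function of the expansion as a formal power series in the couplings**: the generating series of the
connected two-point graphs = chains of 1PI insertions, `G = Σ_{chains l} e^{chainDeg l}·chainAmp l ∈ R[[σ]]`, i.e.
`coeff d G = Σ_{l : chainDeg l = d} chainAmp l` (finite at each order, `coeff_greenSeries`). [cite: Balaban1983Higgs3, (1.21) p.416] -/
def greenSeries : MvPowerSeries σ R :=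
  fun d => ∑ᶠ (l : List ι) (_ : chainDeg deg l = d), chainAmp C0 amp l

variable {C0 amp deg}

/-- kernel: the empty chain has order 0. [cite: Balaban1983Higgs3, (1.21) p.416] -/
@[simp] theorem chainDeg_nil : chainDeg deg [] = 0 := by
  simp [chainDeg]

/-- kernel: orders add along a chain. [cite: Balaban1983Higgs3, (1.21) p.416] -/
@[simp] theorem chainDeg_cons (i : ι) (l : List ι) : chainDeg deg (i :: l) = deg i + chainDeg deg l := by
  simp [chainDeg]

/-- kernel: orders add under concatenation. [cite: Balaban1983Higgs3, (1.21) p.416] -/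
theorem chainDeg_append (l₁ l₂ : List ι) : chainDeg deg (l₁ ++ l₂) = chainDeg deg l₁ + chainDeg deg l₂ := by
  simp [chainDeg, List.sum_append]

/-- kernel: appending one insertion adds its order. [cite: Balaban1983Higgs3, (1.21) p.416] -/
theorem chainDeg_concat (l : List ι) (i : ι) : chainDeg deg (l ++ [i]) = chainDeg deg l + deg i := by
  rw [chainDeg_append, chainDeg_cons, chainDeg_nil, add_zero]

/-- kernel: every piece of a chain has order at most the order of the chain. [cite: Balaban1983Higgs3, (1.21) p.416] -/
theorem deg_le_chainDeg_of_mem {l : List ι} {i : ι} (hi : i ∈ l) : deg i ≤ chainDeg deg l := by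
  induction l with
  | nil => simp at hi
  | cons j l ih =>
    rw [chainDeg_cons]
    rcases List.mem_cons.mp hi with rfl | h
    · exact le_self_add
    · exact le_add_left (ih h)

/-- kernel: a chain of 1PI pieces of POSITIVE order has at most `|chainDeg l|` pieces (`|d| = Finsupp.degree d`, the total order
`α + β`). [cite: Balaban1983Higgs3, (1.21) p.416] -/
theorem length_le_degree_chainDeg (hdeg : ∀ i, deg i ≠ 0) (l : List ι) :
    l.length ≤ (chainDeg deg l).degree := by
  induction l with
  | nil => simp
  | cons i l ih =>
    rw [chainDeg_cons, map_add, List.length_cons]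
    have h1 : 1 ≤ (deg i).degree := by
      rw [Nat.one_le_iff_ne_zero, Ne, Finsupp.degree_eq_zero_iff]
      exact hdeg i
    omega

/-- kernel: the only chain of order 0 is the empty chain. [cite: Balaban1983Higgs3, (1.21) p.416] -/
theorem chainDeg_eq_zero_iff (hdeg : ∀ i, deg i ≠ 0) (l : List ι) : chainDeg deg l = 0 ↔ l = [] := by
  constructor
  · intro h
    have := length_le_degree_chainDeg hdeg l
    rw [h, map_zero, Nat.le_zero, List.length_eq_zero_iff] at this
    exact this
  · rintro rfl
    exact chainDeg_nil

/-- kernel: in a locally finite family, finitely many graphs have order AT MOST `d`. [cite: Balaban1983Higgs3, (1.21) p.416] -/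
theorem finite_deg_le (hfin : ∀ d, {i | deg i = d}.Finite) (d : σ →₀ ℕ) : {i | deg i ≤ d}.Finite := by
  classical
  refine ((antidiagonal d).finite_toSet.biUnion fun p _ => hfin p.1).subset ?_
  intro i hi
  simp only [Set.mem_setOf_eq] at hi
  simp only [Set.mem_iUnion, Finset.mem_coe, mem_antidiagonal, Set.mem_setOf_eq]
  exact ⟨(deg i, d - deg i), add_tsub_cancel_of_le hi, rfl⟩

/-- kernel: finitely many lists of bounded length with entries in a finite set. [folklore] -/
private theorem finite_lists {S : Set ι} (hS : S.Finite) :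
    ∀ N : ℕ, {l : List ι | l.length ≤ N ∧ ∀ i ∈ l, i ∈ S}.Finite
  | 0 => by
    refine (Set.finite_singleton ([] : List ι)).subset ?_
    rintro l ⟨hl, -⟩
    simp only [Set.mem_singleton_iff]
    exact List.length_eq_zero_iff.mp (Nat.le_zero.mp hl)
  | N + 1 => by
    refine ((Set.finite_singleton ([] : List ι)).union
      ((hS.prod (finite_lists hS N)).image fun p => p.1 :: p.2)).subset ?_
    rintro l ⟨hl, hmem⟩
    cases l with
    | nil => exact Or.inl rfl
    | cons i l =>
      refine Or.inr ⟨(i, l), ⟨hmem i (by simp), ?_, fun j hj => hmem j (by simp [hj])⟩, rfl⟩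
      simpa using hl

/-- **At each order there are finitely many chains**: positive orders bound the length by the total order, local finiteness
bounds the entries. PROVED. [cite: Balaban1983Higgs3, (1.21) p.416] -/
theorem finite_chainDeg_eq (hdeg : ∀ i, deg i ≠ 0) (hfin : ∀ d, {i | deg i = d}.Finite) (d : σ →₀ ℕ) :
    {l : List ι | chainDeg deg l = d}.Finite := by
  classical
  refine (finite_lists (finite_deg_le hfin d) (Finsupp.degree d)).subset ?_
  intro l hl
  simp only [Set.mem_setOf_eq] at hl
  subst hl
  exact ⟨length_le_degree_chainDeg hdeg l, fun i hi => deg_le_chainDeg_of_mem hi⟩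

/-- **The coefficients of the self-energy series**: `coeff d X = Σ_{i : deg i = d} amp i` (finite sum). PROVED.
[cite: Balaban1983Higgs3, (1.21) p.416] -/
theorem coeff_sigmaSeries (hfin : ∀ d, {i | deg i = d}.Finite) (d : σ →₀ ℕ) :
    coeff d (sigmaSeries amp deg) = ∑ i ∈ (hfin d).toFinset, amp i := by
  show (∑ᶠ (i : ι) (_ : deg i = d), amp i) = _
  exact finsum_cond_eq_sum_of_cond_iff _ fun _ => by simp

/-- **The coefficients of the two-point series**: `coeff d G = Σ_{chains l : chainDeg l = d} chainAmp l` (finite sum). PROVED.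
[cite: Balaban1983Higgs3, (1.21) p.416] -/
theorem coeff_greenSeries (hdeg : ∀ i, deg i ≠ 0) (hfin : ∀ d, {i | deg i = d}.Finite) (d : σ →₀ ℕ) :
    coeff d (greenSeries C0 amp deg) = ∑ l ∈ (finite_chainDeg_eq hdeg hfin d).toFinset, chainAmp C0 amp l := by
  show (∑ᶠ (l : List ι) (_ : chainDeg deg l = d), chainAmp C0 amp l) = _
  exact finsum_cond_eq_sum_of_cond_iff _ fun _ => by simp

/-- The self-energy series has NO CONSTANT TERM (every 1PI graph has positive order). PROVED. [cite: Balaban1983Higgs3, (1.21) p.416] -/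
theorem constantCoeff_sigmaSeries (hdeg : ∀ i, deg i ≠ 0) (hfin : ∀ d, {i | deg i = d}.Finite) :
    constantCoeff (sigmaSeries amp deg) = 0 := by
  rw [← coeff_zero_eq_constantCoeff_apply, coeff_sigmaSeries hfin]
  refine Finset.sum_eq_zero fun i hi => ?_
  exact absurd ((Set.Finite.mem_toFinset _).mp hi) (hdeg i)

/-- The constant term of the two-point series is the free propagator `C₀` (the empty chain). PROVED.
[cite: Balaban1983Higgs3, (1.21) p.416] -/
theorem constantCoeff_greenSeries (hdeg : ∀ i, deg i ≠ 0) (hfin : ∀ d, {i | deg i = d}.Finite) :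
    constantCoeff (greenSeries C0 amp deg) = C0 := by
  rw [← coeff_zero_eq_constantCoeff_apply, coeff_greenSeries hdeg hfin]
  have hs : (finite_chainDeg_eq hdeg hfin 0).toFinset = {[]} := by
    ext l
    simp [chainDeg_eq_zero_iff hdeg]
  rw [hs, Finset.sum_singleton, chainAmp_nil]

/-- Splitting the family of insertions into two types splits the self-energy additively (so print's five letters
`−δm², Σ^ε, ∂^{ε*}Σ^ε_1, Σ^{ε*}_1∂^ε, ∂^{ε*}Σ^ε_2∂^ε` are the `sigmaSeries` of the five parts of a partition of `ι`). PROVED.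
[cite: Balaban1983Higgs3, (1.21) p.416] -/
theorem sigmaSeries_sum {ι₁ ι₂ : Type*} (amp₁ : ι₁ → R) (deg₁ : ι₁ → σ →₀ ℕ) (amp₂ : ι₂ → R) (deg₂ : ι₂ → σ →₀ ℕ)
    (hfin₁ : ∀ d, {i | deg₁ i = d}.Finite) (hfin₂ : ∀ d, {i | deg₂ i = d}.Finite) :
    sigmaSeries (Sum.elim amp₁ amp₂) (Sum.elim deg₁ deg₂) = sigmaSeries amp₁ deg₁ + sigmaSeries amp₂ deg₂ := by
  have hfin : ∀ d, {i : ι₁ ⊕ ι₂ | Sum.elim deg₁ deg₂ i = d}.Finite := by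
    intro d
    refine (((hfin₁ d).image Sum.inl).union ((hfin₂ d).image Sum.inr)).subset ?_
    rintro (i | i) hi
    · exact Or.inl ⟨i, hi, rfl⟩
    · exact Or.inr ⟨i, hi, rfl⟩
  ext d
  rw [map_add, coeff_sigmaSeries hfin, coeff_sigmaSeries hfin₁, coeff_sigmaSeries hfin₂]
  have hs : (hfin d).toFinset = Finset.disjSum (hfin₁ d).toFinset (hfin₂ d).toFinset := by
    ext i
    rcases i with i | i <;> simp
  rw [hs, Finset.sum_disjSum]
  rfl

end Series

/-! ## §4 The resummed form (Dyson equation) holds exactly in `R[[σ]]` -/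

section Dyson

variable {C0 : R} {amp : ι → R} {deg : ι → σ →₀ ℕ}

/-- kernel (the reindexing behind the resummation): summing a function of chains over the NONEMPTY chains of order `d` is
summing, over the splittings `d = d₁ + d₂`, over the chains `l` of order `d₁` and the 1PI graphs `i` of order `d₂`, its value at
`l ++ [i]` — every nonempty chain is uniquely (its chain of all but the last piece) ++ [its last piece]. PROVED.
[cite: Balaban1983Higgs3, (1.21) p.416] -/
theorem sum_chains_ne_nil_eq [DecidableEq σ] {M : Type*} [AddCommMonoid M] (hdeg : ∀ i, deg i ≠ 0)
    (hfin : ∀ d, {i | deg i = d}.Finite) (d : σ →₀ ℕ) (f : List ι → M) :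
    ∑ l ∈ (finite_chainDeg_eq hdeg hfin d).toFinset with 0 < l.length, f l
      = ∑ p ∈ antidiagonal d, ∑ l ∈ (finite_chainDeg_eq hdeg hfin p.1).toFinset,
          ∑ i ∈ (hfin p.2).toFinset, f (l ++ [i]) := by
  -- the right-hand side as one sum over the splittings `⟨(d₁, d₂), (l, i)⟩`
  have step : (∑ p ∈ antidiagonal d, ∑ l ∈ (finite_chainDeg_eq hdeg hfin p.1).toFinset,
        ∑ i ∈ (hfin p.2).toFinset, f (l ++ [i]))
      = ∑ x ∈ (antidiagonal d).sigma
          (fun p => (finite_chainDeg_eq hdeg hfin p.1).toFinset ×ˢ (hfin p.2).toFinset),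
          f (x.2.1 ++ [x.2.2]) := by
    rw [Finset.sum_sigma]
    refine Finset.sum_congr rfl fun p _ => ?_
    rw [Finset.sum_product]
  rw [step]
  symm
  -- the bijection `(l, i) ↦ l ++ [i]`, inverse `l ↦ (all but the last piece, the last piece)`
  refine Finset.sum_bij' (fun x _ => x.2.1 ++ [x.2.2])
    (fun l hl => ⟨(chainDeg deg l.dropLast,
        deg (l.getLast (List.ne_nil_of_length_pos (Finset.mem_filter.mp hl).2))),
      (l.dropLast, l.getLast (List.ne_nil_of_length_pos (Finset.mem_filter.mp hl).2))⟩)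
    ?_ ?_ ?_ ?_ (fun _ _ => rfl)
  · -- a splitting gives a nonempty chain of order `d`
    rintro ⟨p, l, i⟩ hx
    simp only [Finset.mem_sigma, mem_antidiagonal, Finset.mem_product, Set.Finite.mem_toFinset,
      Set.mem_setOf_eq] at hx
    obtain ⟨hp, hl, hi⟩ := hx
    simp [Set.Finite.mem_toFinset, chainDeg_concat, hl, hi, hp]
  · -- (all but the last piece, the last piece) of a nonempty chain of order `d` is a splitting of `d`
    intro l hl
    obtain ⟨hl1, hl2⟩ := Finset.mem_filter.mp hl
    have hne : l ≠ [] := List.ne_nil_of_length_pos hl2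
    have hd : chainDeg deg l = d := by simpa using hl1
    have key : chainDeg deg l.dropLast + deg (l.getLast hne) = d := by
      conv_rhs => rw [← hd, ← List.dropLast_append_getLast hne]
      rw [chainDeg_concat]
    refine Finset.mem_sigma.mpr ⟨mem_antidiagonal.mpr key, Finset.mem_product.mpr ⟨?_, ?_⟩⟩
    · simp [Set.Finite.mem_toFinset]
    · simp [Set.Finite.mem_toFinset]
  · -- round trip from a splitting
    rintro ⟨p, l, i⟩ hx
    simp only [Finset.mem_sigma, mem_antidiagonal, Finset.mem_product, Set.Finite.mem_toFinset,
      Set.mem_setOf_eq] at hx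
    obtain ⟨-, hl, hi⟩ := hx
    have h1 : (l ++ [i]).dropLast = l := List.dropLast_concat
    have h2 : ∀ h, (l ++ [i]).getLast h = i := fun _ => List.getLast_append_singleton l
    refine Sigma.ext ?_ ?_
    · simp only [h1, h2, hl, hi, Prod.mk.eta]
    · simp only [h1, h2, heq_eq_eq]
  · -- round trip from a nonempty chain
    intro l hl
    exact List.dropLast_append_getLast _

/-- kernel: the coefficient of `φ·X·C₀` — for ANY series `φ`, `coeff d (φ·X·C C₀) = Σ_{d₁+d₂=d} Σ_{i : deg i = d₂}
coeff d₁ φ · amp i · C₀`. PROVED. [cite: Balaban1983Higgs3, (1.21) p.416] -/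
theorem coeff_mul_sigmaSeries_mul_C [DecidableEq σ] (hfin : ∀ d, {i | deg i = d}.Finite) (φ : MvPowerSeries σ R)
    (d : σ →₀ ℕ) :
    coeff d (φ * sigmaSeries amp deg * C C0)
      = ∑ p ∈ antidiagonal d, ∑ i ∈ (hfin p.2).toFinset, coeff p.1 φ * amp i * C0 := by
  rw [coeff_mul_C, coeff_mul, Finset.sum_mul]
  refine Finset.sum_congr rfl fun p _ => ?_
  rw [coeff_sigmaSeries hfin, Finset.mul_sum, Finset.sum_mul]

/-- kernel: the coefficient of `G·X·C₀` is the sum over the NONEMPTY chains: `coeff d (G·X·C C₀) = Σ_{l ≠ [], chainDeg l = d}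
chainAmp l`. PROVED. [cite: Balaban1983Higgs3, (1.21) p.416] -/
theorem coeff_greenSeries_mul_sigmaSeries_mul_C (hdeg : ∀ i, deg i ≠ 0) (hfin : ∀ d, {i | deg i = d}.Finite)
    (d : σ →₀ ℕ) :
    coeff d (greenSeries C0 amp deg * sigmaSeries amp deg * C C0)
      = ∑ l ∈ (finite_chainDeg_eq hdeg hfin d).toFinset with 0 < l.length, chainAmp C0 amp l := by
  classical
  rw [coeff_mul_sigmaSeries_mul_C hfin, sum_chains_ne_nil_eq hdeg hfin d]
  refine Finset.sum_congr rfl fun p _ => ?_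
  rw [coeff_greenSeries hdeg hfin, Finset.sum_comm]
  simp_rw [Finset.sum_mul, chainAmp_concat]

/-- **(1.21) in its resummed form holds EXACTLY for the formal perturbative series**: in `R[[σ]]`,
`G = C₀ + G·X·C₀` — r15's `B3Sect1TwoPoint.Eq121 G (C C₀) X` — for `G = greenSeries` (the chains of 1PI insertions) and
`X = sigmaSeries` (the 1PI insertions): a chain is empty or (a chain) ++ [a 1PI piece]. PROVED. [cite: Balaban1983Higgs3, (1.21) p.416] -/
theorem eq121_greenSeries (hdeg : ∀ i, deg i ≠ 0) (hfin : ∀ d, {i | deg i = d}.Finite) :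
    Eq121 (greenSeries C0 amp deg) (C C0) (sigmaSeries amp deg) := by
  classical
  unfold Eq121
  ext d
  rw [map_add, coeff_greenSeries_mul_sigmaSeries_mul_C hdeg hfin, coeff_greenSeries hdeg hfin, coeff_C,
    ← Finset.sum_filter_add_sum_filter_not _ (fun l : List ι => 0 < l.length)]
  rw [add_comm]
  congr 1
  -- the chains of length 0 and order d: the empty chain if d = 0, none otherwise
  have hs : ((finite_chainDeg_eq hdeg hfin d).toFinset.filter fun l : List ι => ¬ 0 < l.length)
      = if d = 0 then {[]} else ∅ := by
    ext l
    simp only [Finset.mem_filter, Set.Finite.mem_toFinset, Set.mem_setOf_eq, not_lt, Nat.le_zero,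
      List.length_eq_zero_iff]
    split_ifs with hd
    · simp only [Finset.mem_singleton]
      constructor
      · exact fun h => h.2
      · rintro rfl; exact ⟨by simp [hd], rfl⟩
    · simp only [Finset.notMem_empty, iff_false, not_and]
      rintro h rfl
      exact hd (by simpa using h.symm)
  rw [hs]
  split_ifs <;> simp

end Dyson

/-! ## §5 The `n`-th term of (1.21) at order `d` = the chains of exactly `n` insertions of total order `d` -/

section Graded

variable {C0 : R} {amp : ι → R} {deg : ι → σ →₀ ℕ}

/-- kernel: `dysonTerm C₀ X (n+1) = dysonTerm C₀ X n · X · C₀`. [cite: Balaban1983Higgs3, (1.21) p.416] -/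
theorem dysonTerm_succ {S : Type*} [Ring S] (C0 X : S) (n : ℕ) :
    dysonTerm C0 X (n + 1) = dysonTerm C0 X n * X * C0 := by
  simp only [dysonTerm, pow_succ, mul_assoc]

/-- **THE COMBINATORIAL IDENTITY (graded form)**: at every order `d` and for every `n`, the coefficient of the `n`-th term
`C₀[XC₀]ⁿ` of (1.21) (with `C₀ ↦ C C₀`, `X ↦ sigmaSeries`) is the sum of the values `chainAmp l` of the chains `l` of EXACTLY `n`
one-particle-irreducible insertions and total order `d`. PROVED (induction on `n`, reindexing `sum_chains_ne_nil_eq`).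
[cite: Balaban1983Higgs3, (1.21) p.416] -/
theorem coeff_dysonTerm_eq_sum_chains (hdeg : ∀ i, deg i ≠ 0) (hfin : ∀ d, {i | deg i = d}.Finite) (n : ℕ)
    (d : σ →₀ ℕ) :
    coeff d (dysonTerm (C C0) (sigmaSeries amp deg) n)
      = ∑ l ∈ (finite_chainDeg_eq hdeg hfin d).toFinset with l.length = n, chainAmp C0 amp l := by
  classical
  induction n generalizing d with
  | zero =>
    rw [dysonTerm, pow_zero, mul_one, coeff_C]
    have hs : ((finite_chainDeg_eq hdeg hfin d).toFinset.filter fun l : List ι => l.length = 0)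
        = if d = 0 then {[]} else ∅ := by
      ext l
      simp only [Finset.mem_filter, Set.Finite.mem_toFinset, Set.mem_setOf_eq, List.length_eq_zero_iff]
      split_ifs with hd
      · simp only [Finset.mem_singleton]
        constructor
        · exact fun h => h.2
        · rintro rfl; exact ⟨by simp [hd], rfl⟩
      · simp only [Finset.notMem_empty, iff_false, not_and]
        rintro h rfl
        exact hd (by simpa using h.symm)
    rw [hs]
    split_ifs <;> simp
  | succ n ih =>
    rw [dysonTerm_succ, coeff_mul_sigmaSeries_mul_C hfin]
    -- right-hand side: nonempty chains, split off the last piece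
    have key := sum_chains_ne_nil_eq hdeg hfin d
      (fun l : List ι => if l.length = n + 1 then chainAmp C0 amp l else 0)
    have lhs : (∑ l ∈ (finite_chainDeg_eq hdeg hfin d).toFinset with l.length = n + 1, chainAmp C0 amp l)
        = ∑ l ∈ (finite_chainDeg_eq hdeg hfin d).toFinset with 0 < l.length,
            (if l.length = n + 1 then chainAmp C0 amp l else 0) := by
      rw [← Finset.sum_filter, Finset.filter_filter]
      refine Finset.sum_congr ?_ fun _ _ => rfl
      ext l
      simp only [Finset.mem_filter, and_congr_right_iff]
      intro
      omega
    rw [lhs, key]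
    refine Finset.sum_congr rfl fun p _ => ?_
    rw [ih p.1]
    simp_rw [Finset.sum_mul]
    rw [Finset.sum_comm, Finset.sum_filter]
    refine Finset.sum_congr rfl fun l _ => ?_
    simp only [List.length_append, List.length_singleton, Nat.add_right_cancel_iff, chainAmp_concat]
    by_cases h : l.length = n <;> simp [h]

/-- **No chain of `n` insertions has total order below `n`**: `coeff d (C₀[XC₀]ⁿ) = 0` whenever `|d| < n` — so at each
perturbative order only finitely many terms of (1.21) contribute. PROVED. [cite: Balaban1983Higgs3, (1.21) p.416] -/
theorem coeff_dysonTerm_eq_zero_of_degree_lt (hdeg : ∀ i, deg i ≠ 0) (hfin : ∀ d, {i | deg i = d}.Finite) {n : ℕ}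
    {d : σ →₀ ℕ} (h : d.degree < n) :
    coeff d (dysonTerm (C C0) (sigmaSeries amp deg) n) = 0 := by
  rw [coeff_dysonTerm_eq_sum_chains hdeg hfin]
  refine Finset.sum_eq_zero fun l hl => ?_
  exfalso
  simp only [Finset.mem_filter, Set.Finite.mem_toFinset, Set.mem_setOf_eq] at hl
  have := length_le_degree_chainDeg hdeg l (deg := deg)
  rw [hl.1, hl.2] at this
  omega

end Graded

/-! ## §6 (1.21) order by order, and as a convergent series in `R[[σ]]` -/

section OrderByOrder

variable {C0 : R} {amp : ι → R} {deg : ι → σ →₀ ℕ}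

/-- **(1.21) ORDER BY ORDER**: at every order `d` the two-point series is the FINITE sum of the first `|d| + 1` terms of the
printed series, `coeff d G = Σ_{n ≤ |d|} coeff d (C₀[XC₀]ⁿ)` (group the chains of order `d` by their number of 1PI pieces,
`≤ |d|`). PROVED. [cite: Balaban1983Higgs3, (1.21) p.416] -/
theorem coeff_greenSeries_eq_sum_dysonTerm (hdeg : ∀ i, deg i ≠ 0) (hfin : ∀ d, {i | deg i = d}.Finite) (d : σ →₀ ℕ) :
    coeff d (greenSeries C0 amp deg)
      = ∑ n ∈ Finset.range (d.degree + 1), coeff d (dysonTerm (C C0) (sigmaSeries amp deg) n) := by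
  classical
  rw [coeff_greenSeries hdeg hfin]
  simp_rw [coeff_dysonTerm_eq_sum_chains hdeg hfin]
  symm
  refine Finset.sum_fiberwise_of_maps_to (g := List.length) (fun l hl => ?_) _
  simp only [Set.Finite.mem_toFinset, Set.mem_setOf_eq] at hl
  rw [Finset.mem_range, Nat.lt_succ_iff, ← hl]
  exact length_le_degree_chainDeg hdeg l

/-- The same with any cut-off `N > |d|`: `coeff d G = Σ_{n<N} coeff d (C₀[XC₀]ⁿ)` = the order-`d` coefficient of r15's partial sum
`Σ_{n<N} dysonTerm` (`B3Sect1TwoPoint.dyson_partial`), the remainder having no order-`d` part. PROVED. [cite: Balaban1983Higgs3, (1.21) p.416] -/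
theorem coeff_greenSeries_eq_coeff_partialSum (hdeg : ∀ i, deg i ≠ 0) (hfin : ∀ d, {i | deg i = d}.Finite) (d : σ →₀ ℕ)
    {N : ℕ} (hN : d.degree < N) :
    coeff d (greenSeries C0 amp deg)
      = coeff d (∑ n ∈ Finset.range N, dysonTerm (C C0) (sigmaSeries amp deg) n) := by
  rw [map_sum, coeff_greenSeries_eq_sum_dysonTerm hdeg hfin]
  refine Finset.sum_subset (Finset.range_subset_range.mpr (by omega)) fun n _ hn' => ?_
  simp only [Finset.mem_range, not_lt] at hn'
  exact coeff_dysonTerm_eq_zero_of_degree_lt hdeg hfin (by omega)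

/-- **FIRST ORDER** (the owner's wish 2026-08-23T08:12:00Z, for p39's BRICK 1 `B3Eq122FirstOrderWick`): at an order `d` of
total degree `|d| = 1` (e.g. `d = (0,1)`, the coefficient of `λ¹`) the only chains of order `d` are the single insertions of order
`d`, so `coeff d G = C₀·(coeff d X)·C₀` — print's «G = C₀ + C₀·Σ_{(0,1)}·C₀ + O(λ²)» read off (1.21). PROVED.
[cite: Balaban1983Higgs3, (1.21) p.416] -/
theorem coeff_greenSeries_of_degree_eq_one (hdeg : ∀ i, deg i ≠ 0) (hfin : ∀ d, {i | deg i = d}.Finite) {d : σ →₀ ℕ}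
    (hd : d.degree = 1) :
    coeff d (greenSeries C0 amp deg) = C0 * coeff d (sigmaSeries amp deg) * C0 := by
  classical
  have hd0 : d ≠ 0 := by
    rintro rfl
    rw [map_zero] at hd
    exact zero_ne_one hd
  rw [coeff_greenSeries_eq_sum_dysonTerm hdeg hfin, hd, Finset.sum_range_succ, Finset.sum_range_one, dysonTerm,
    pow_zero, mul_one, coeff_C, if_neg hd0, zero_add, dysonTerm, pow_one, ← mul_assoc, coeff_mul_C, coeff_C_mul]

/-- The same with the 1PI graphs of order `d` listed: `coeff d G = C₀·(Σ_{i : deg i = d} amp i)·C₀` for `|d| = 1`. PROVED.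
[cite: Balaban1983Higgs3, (1.21) p.416] -/
theorem coeff_greenSeries_of_degree_eq_one' (hdeg : ∀ i, deg i ≠ 0) (hfin : ∀ d, {i | deg i = d}.Finite) {d : σ →₀ ℕ}
    (hd : d.degree = 1) :
    coeff d (greenSeries C0 amp deg) = C0 * (∑ i ∈ (hfin d).toFinset, amp i) * C0 := by
  rw [coeff_greenSeries_of_degree_eq_one hdeg hfin hd, coeff_sigmaSeries hfin]

end OrderByOrder

/-! ## §7 The printed infinite series converges to `G` in the topology of formal power series -/

section Topology

open MvPowerSeries.WithPiTopology

variable [TopologicalSpace R] {C0 : R} {amp : ι → R} {deg : ι → σ →₀ ℕ}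

/-- **The printed `Σ_{n=0}^∞` CONVERGES in `R[[σ]]`**: for ANY topology on the kernels `R` (the product topology on
coefficients), `Σ_n C₀[XC₀]ⁿ` has sum `G` — at each order the partial sums are eventually constant. PROVED.
[cite: Balaban1983Higgs3, (1.21) p.416] -/
theorem hasSum_dysonTerm_greenSeries (hdeg : ∀ i, deg i ≠ 0) (hfin : ∀ d, {i | deg i = d}.Finite) :
    HasSum (fun n => dysonTerm (C C0) (sigmaSeries amp deg) n) (greenSeries C0 amp deg) := by
  rw [hasSum_iff_hasSum_coeff]
  intro d
  rw [coeff_greenSeries_eq_sum_dysonTerm hdeg hfin]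
  exact hasSum_sum_of_ne_finset_zero fun n hn => by
    simp only [Finset.mem_range, not_lt] at hn
    exact coeff_dysonTerm_eq_zero_of_degree_lt hdeg hfin (by omega)

/-- the terms of (1.21) form a summable family in `R[[σ]]`. [cite: Balaban1983Higgs3, (1.21) p.416] -/
theorem summable_dysonTerm_sigmaSeries (hdeg : ∀ i, deg i ≠ 0) (hfin : ∀ d, {i | deg i = d}.Finite) :
    Summable (fun n => dysonTerm (C C0) (sigmaSeries amp deg) n) :=
  (hasSum_dysonTerm_greenSeries hdeg hfin).summable

/-- **(1.21) LITERALLY, as printed**: `G = Σ'_{n} C₀[XC₀]ⁿ` in `R[[σ]]` (coefficients Hausdorff), with `G` the generating series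
of the chains of 1PI insertions and `X` that of the 1PI insertions. PROVED. [cite: Balaban1983Higgs3, (1.21) p.416] -/
theorem greenSeries_eq_tsum_dysonTerm [T2Space R] (hdeg : ∀ i, deg i ≠ 0) (hfin : ∀ d, {i | deg i = d}.Finite) :
    greenSeries C0 amp deg = ∑' n, dysonTerm (C C0) (sigmaSeries amp deg) n :=
  (hasSum_dysonTerm_greenSeries hdeg hfin).tsum_eq.symm

end Topology

/-! ## §8 Uniqueness: the resummed form of record and the chain expansion define the same formal series -/

section Unique

variable {C0 : R} {amp : ι → R} {deg : ι → σ →₀ ℕ}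

/-- kernel: `Eq121 G C₀ X` says `G·(1 − X·C₀) = C₀` (any ring). [cite: Balaban1983Higgs3, (1.21) p.416] -/
theorem mul_one_sub_of_eq121 {S : Type*} [Ring S] {G C0 X : S} (h : Eq121 G C0 X) : G * (1 - X * C0) = C0 := by
  unfold Eq121 at h
  rw [mul_sub, mul_one, ← mul_assoc, sub_eq_iff_eq_add]
  exact h

/-- kernel: `1 − X·C₀` has constant coefficient `1` (the self-energy has no constant term), hence is a unit of `R[[σ]]`.
[cite: Balaban1983Higgs3, (1.21) p.416] -/
theorem constantCoeff_one_sub_sigmaSeries_mul_C (hdeg : ∀ i, deg i ≠ 0) (hfin : ∀ d, {i | deg i = d}.Finite) :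
    constantCoeff (1 - sigmaSeries amp deg * C C0) = 1 := by
  rw [map_sub, map_one, map_mul, constantCoeff_sigmaSeries hdeg hfin, zero_mul, sub_zero]

/-- **UNIQUENESS in `R[[σ]]`**: every formal series `G` satisfying the resummed form of record `Eq121 G (C C₀) X` with
`X = sigmaSeries` IS the chain expansion `greenSeries` (right-multiply `(G − G_chains)(1 − XC₀) = 0` by the inverse of the
unit `1 − XC₀`). So r15's typed (1.21) and the sum over chains of 1PI graphs define the same formal two-point function. PROVED.
[cite: Balaban1983Higgs3, (1.21) p.416] -/
theorem eq_greenSeries_of_eq121 (hdeg : ∀ i, deg i ≠ 0) (hfin : ∀ d, {i | deg i = d}.Finite)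
    {G : MvPowerSeries σ R} (hG : Eq121 G (C C0) (sigmaSeries amp deg)) : G = greenSeries C0 amp deg := by
  classical
  have h1 := mul_one_sub_of_eq121 hG
  have h2 := mul_one_sub_of_eq121 (eq121_greenSeries (C0 := C0) (amp := amp) (deg := deg) hdeg hfin)
  have hu : constantCoeff (1 - sigmaSeries amp deg * C C0) = ((1 : Rˣ) : R) := by
    rw [Units.val_one]
    exact constantCoeff_one_sub_sigmaSeries_mul_C hdeg hfin
  have key : (G - greenSeries C0 amp deg) * (1 - sigmaSeries amp deg * C C0) = 0 := by
    rw [sub_mul, h1, h2, sub_self]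
  have := congrArg (· * (1 - sigmaSeries amp deg * C C0).invOfUnit 1) key
  simp only [zero_mul, mul_assoc, mul_invOfUnit _ _ hu, mul_one] at this
  exact sub_eq_zero.mp this

/-- (1.21): the resummed form of record holds for `G` IFF `G` is the chain expansion. PROVED.
[cite: Balaban1983Higgs3, (1.21) p.416] -/
theorem eq121_iff_eq_greenSeries (hdeg : ∀ i, deg i ≠ 0) (hfin : ∀ d, {i | deg i = d}.Finite)
    {G : MvPowerSeries σ R} : Eq121 G (C C0) (sigmaSeries amp deg) ↔ G = greenSeries C0 amp deg :=
  ⟨eq_greenSeries_of_eq121 hdeg hfin, fun h => h ▸ eq121_greenSeries hdeg hfin⟩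

end Unique

end

end Literature.MathematicalPhysics.QuantumFieldTheory.Balaban1983to89.B3Eq121OnePIChains
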